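import Summits.SmoothPoincare4.SmoothPoincare4.Theses.RicciFat
import HarnessLib

/-!
# Line `birth` — BC3 skeleton for the crux `RicciFat.RecognitionBeyondWeylGap` (stmt-SmoothPoincare4-18049)

Route `route-SmoothPoincare4-RicciFat`, rank-5 crux (piece 1/2 of the Weyl-gap threshold split of
`RicciFatSphere`), decl `Summit.SmoothPoincare4.SmoothPoincare4.Theses.RicciFat.RecognitionBeyondWeylGap`:

  a closed smooth `M ≃ₕ S⁴` carrying a `C^∞` Riemannian metric `h` (with its Levi-Civita connection)
  with `Ric_h ≥ 3h` and `Vol(M, h) > 8π²/9 = Vol(S⁴)/3` is diffeomorphic to `S⁴`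
  — "Cheeger–Colding's `δ(4)` can be taken `= 2/3` on homotopy 4-spheres".

## The line: EINSTEIN REDUCTION + the GURSKY–LEBRUN WEYL GAP

* `stub_einsteinReduction` — OPEN (the bet): a closed smooth homotopy 4-sphere that is fat beyond the
  Weyl gap carries an EINSTEIN metric `Ric = 3g` that is fat beyond the Weyl gap. Mechanism: the direct
  method for `V(M) = sup {Vol(M, g) : Ric_g ≥ 3g}` — Gromov precompactness and the stability of
  `Ric ≥ 3` under measured Gromov–Hausdorff convergence (Lott–Villani–Sturm) give a volume-MAXIMAL
  `RCD(3,4)` limit `X` with `H⁴(X) = V(M) > 8π²/9` (Colding's volume continuity for non-collapsed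
  sequences); Bishop–Gromov on `X` gives every tangent-cone density `θ_p ≥ V(M)/Vol(S⁴) > 1/3`, so among
  the cones `C(S³/Γ)` only `Γ = ℤ₂` survives, and replacing a cone point by a `Ric ≥ 0` ALE cap RAISES
  volume (the Bishop–Gromov ratio of the cap decreases from `1` to the cone density), which a maximal
  limit forbids; a smooth maximiser with `Ric ≥ 3` should be Einstein by first variation (a conformal
  bump `e^{2u}g`, `u ≥ 0`, supported where `Ric > 3`, raises volume). Why it might fail: maximising
  sequences may converge to a space with a codimension-2 singular set (cone edges `C(S¹_β) × ℝ²` have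
  any density `β/2π`), or the smooth maximiser may be non-Einstein with `Ric ≥ 3` saturated only on a
  sub-bundle of directions. Sources: CheegerColding1997, Colding1997, CheegerNaber2015 (codimension 4
  for bounded Ricci), Anderson1989/BandoKasueNakajima1989 (orbifold compactness of Einstein 4-manifolds).
* `stub_einsteinWeylGap` — KNOWN (classical, to be vendored as Literature facts; M in Lean): an Einstein
  metric `Ric = 3g` on a closed smooth homotopy 4-sphere with `Vol > 8π²/9` makes it diffeomorphic (indeed
  isometric) to the round `S⁴`. Proof in print: Gursky–LeBrun 1999, Thm 1 and Cor 1 (arXiv:math/9807055,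
  p. 8; originally Gursky 1998): for a compact oriented Einstein 4-manifold with `s > 0`,
  `W⁺ ≢ 0 ⇒ ∫|W⁺|² ≥ ∫ s²/24` and `W⁻ ≢ 0 ⇒ ∫|W⁻|² ≥ ∫ s²/24`; the Einstein Chern–Gauss–Bonnet /
  Hirzebruch formulas `(2χ ∓ 3τ)(M) = (1/4π²) ∫ [2|W^∓|² + s²/24] dμ` (Besse 1987, 6.31–6.35) then give,
  at `s = 12` (`Ric = 3g`, `s²/24 = 6`) and `χ = 2`, `τ = 0` (M ≃ₕ S⁴, simply connected hence
  orientable): `W^∓ ≢ 0 ⇒ 4 ≥ (3/4π²)·6·Vol`, i.e. `Vol ≤ 8π²/9`. So `Vol > 8π²/9` forces `W ≡ 0`: a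
  conformally flat Einstein metric has constant sectional curvature (`= 1`), and a compact simply
  connected space form of curvature `1` is isometric to the round `S⁴` (Killing–Hopf). Why it might
  fail: only by mis-transcription (the orientation/`χ`/`τ` bookkeeping; strict `>` is used so the
  equality cases `∇W^± ≡ 0` never arise). Sources: GurskyLeBrun1999, Gursky1998, Besse1987, Hitchin1974
  (context: half-conformally-flat Einstein), Wolf (space forms).
* `RecognitionBeyondWeylGap_of : RecognitionBeyondWeylGap` — the crux BY NAME from the two declared stubs
  (modus ponens per `M`; the stubs are the only `sorry`s of the file).

Logical status: `SPC4 ⇒` the crux and both stubs (round metric transported; stub 2 is a theorem);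
stubs `⇒` crux (this file); crux `∧ FatBeyondWeylGap ⇒ RicciFatSphere ⇒ SPC4` (route `closes`). Neither
stub is cheaply the crux or the summit (BC3 probes, planner folder `bc/probe_R_stubs.lean`). Disproof
used: none exists for this crux (new item, no workfiles). Barriers: none of the catalogued
`Literature.Barriers.SmoothPoincare4.*` classes is engaged (a diffeomorphism is recognised from a METRIC
via curvature integrals; no homeomorphism-, stabilisation-, h-cobordism- or gauge-invariant is used).
-/

noncomputable section

open scoped Manifold ContDiff Topology ENNReal
open ContinuousMap
open Literature.Geometry.Lorentzian (PseudoRiemannianMetric riemannianMeasure)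
open Literature.Geometry.Riemannian
open Summit.SmoothPoincare4.SmoothPoincare4.Theses.RicciFat (RecognitionBeyondWeylGap)

-- `Summit.<Summit>.<Problem>`: for the single-conjunct summit the duplicate segment is mandated.
set_option linter.dupNamespace false
set_option linter.unusedVariables false

namespace Summit.SmoothPoincare4.SmoothPoincare4.Cruxes.RecognitionBeyondWeylGap.Birth

/-! ## The two registered stubs (`sorry` lives ONLY here) -/

/-- **Stub 1 (OPEN — the bet): EINSTEIN REDUCTION.** A closed smooth homotopy 4-sphere `M` (Hausdorff,
second countable, `C^∞` atlas on `ℝ⁴`, compact, Borel) carrying a `C^∞` Riemannian metric with its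
Levi-Civita connection, `Ric ≥ 3` and `Vol > 8π²/9` carries an EINSTEIN `C^∞` Riemannian metric `h`
(`Ric_h(v, w) = 3 h(v, w)` for all tangent vectors) with `Vol(M, h) > 8π²/9`. Mechanism: maximise the
volume over `{Ric ≥ 3}` (RCD(3,4)-compactness, Colding volume continuity, Bishop–Gromov density `> 1/3`
at every point of a maximal limit, cone-smoothing raises volume, first variation at a smooth maximiser).
Why it might fail: maximising sequences may converge to a space with codimension-2 singularities, or a
smooth maximiser may fail to be Einstein. Size: open problem.
[cite: CheegerColding1997, Thm. A.1.10 (context)] [cite: Colding1997, volume convergence] -/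
theorem stub_einsteinReduction :
    ∀ (M : Type) [TopologicalSpace M] [T2Space M] [SecondCountableTopology M]
      [ChartedSpace (EuclideanSpace ℝ (Fin 4)) M] [IsManifold (𝓡 4) ∞ M] [CompactSpace M]
      [MeasurableSpace M] [BorelSpace M], M ≃ₕ Metric.sphere (0 : EuclideanSpace ℝ (Fin 5)) 1 →
      (∃ h : Bundle.ContMDiffRiemannianMetric (𝓡 4) ∞ (EuclideanSpace ℝ (Fin 4))
          (TangentSpace (𝓡 4) : M → Type _),
        ∃ _ : (Literature.Geometry.Lorentzian.PseudoRiemannianMetric.ofRiemannian h).HasLeviCivita,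
          (∀ (x : M) (v : TangentSpace (𝓡 4) x), 3 * h.inner x v v ≤
            (Literature.Geometry.Lorentzian.PseudoRiemannianMetric.ofRiemannian h).ricci x v v) ∧
          ENNReal.ofReal (8 * Real.pi ^ 2 / 9) <
            Literature.Geometry.Lorentzian.riemannianMeasure h Set.univ) →
      ∃ h : Bundle.ContMDiffRiemannianMetric (𝓡 4) ∞ (EuclideanSpace ℝ (Fin 4))
          (TangentSpace (𝓡 4) : M → Type _),
        ∃ _ : (Literature.Geometry.Lorentzian.PseudoRiemannianMetric.ofRiemannian h).HasLeviCivita,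
          (∀ (x : M) (v w : TangentSpace (𝓡 4) x),
            (Literature.Geometry.Lorentzian.PseudoRiemannianMetric.ofRiemannian h).ricci x v w =
              3 * h.inner x v w) ∧
          ENNReal.ofReal (8 * Real.pi ^ 2 / 9) <
            Literature.Geometry.Lorentzian.riemannianMeasure h Set.univ := by
  sorry

/-- **Stub 2 (KNOWN — the Gursky–LeBrun Einstein Weyl gap on homotopy 4-spheres).** A closed smooth
homotopy 4-sphere `M` carrying an EINSTEIN `C^∞` Riemannian metric `h` with `Ric_h = 3h` and
`Vol(M, h) > 8π²/9 = Vol(S⁴)/3` is diffeomorphic to `S⁴`. Proof in print: Gursky–LeBrun 1999 Thm 1 /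
Cor 1 (`W^± ≢ 0 ⇒ ∫|W^±|² ≥ ∫ s²/24` for compact oriented Einstein 4-manifolds with `s > 0`) and the
Einstein Gauss–Bonnet/Hirzebruch formulas `(2χ ∓ 3τ) = (1/4π²)∫[2|W^∓|² + s²/24]` give, at `s = 12`,
`χ = 2`, `τ = 0`: `W^∓ ≢ 0 ⇒ Vol ≤ 8π²/9`; hence `W ≡ 0`, the metric has constant curvature `1`, and a
compact simply connected space form of curvature `1` is the round `S⁴` (Killing–Hopf). `M ≃ₕ S⁴` is
simply connected, hence orientable, with `χ = 2`, `τ = 0`. Size M (once the three classical facts are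
vendored). [cite: GurskyLeBrun1999, Thm. 1 and Cor. 1 (arXiv:math/9807055 p. 8)]
[cite: Besse1987, 6.31–6.35] -/
theorem stub_einsteinWeylGap :
    ∀ (M : Type) [TopologicalSpace M] [T2Space M] [SecondCountableTopology M]
      [ChartedSpace (EuclideanSpace ℝ (Fin 4)) M] [IsManifold (𝓡 4) ∞ M] [CompactSpace M]
      [MeasurableSpace M] [BorelSpace M], M ≃ₕ Metric.sphere (0 : EuclideanSpace ℝ (Fin 5)) 1 →
      (∃ h : Bundle.ContMDiffRiemannianMetric (𝓡 4) ∞ (EuclideanSpace ℝ (Fin 4))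
          (TangentSpace (𝓡 4) : M → Type _),
        ∃ _ : (Literature.Geometry.Lorentzian.PseudoRiemannianMetric.ofRiemannian h).HasLeviCivita,
          (∀ (x : M) (v w : TangentSpace (𝓡 4) x),
            (Literature.Geometry.Lorentzian.PseudoRiemannianMetric.ofRiemannian h).ricci x v w =
              3 * h.inner x v w) ∧
          ENNReal.ofReal (8 * Real.pi ^ 2 / 9) <
            Literature.Geometry.Lorentzian.riemannianMeasure h Set.univ) →
      Nonempty (M ≃ₘ⟮𝓡 4, 𝓡 4⟯ Metric.sphere (0 : EuclideanSpace ℝ (Fin 5)) 1) := by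
  sorry

/-! ## The composition: the two stubs prove the crux BY NAME (no `sorry` below this line) -/

/-- **THE SKELETON THEOREM.** The crux
`Summit.SmoothPoincare4.SmoothPoincare4.Theses.RicciFat.RecognitionBeyondWeylGap`, concluded BY NAME from
the two DECLARED stubs `stub_einsteinReduction`, `stub_einsteinWeylGap` (the only `sorry`s of the file):
a fat-beyond-the-gap metric is upgraded to an Einstein one (stub 1), which the Weyl gap recognises
(stub 2) — modus ponens per `M`. [cite: GurskyLeBrun1999, Thm. 1] -/
theorem RecognitionBeyondWeylGap_of : RecognitionBeyondWeylGap := by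
  intro M _ _ _ _ _ _ _ _ e hfat
  exact stub_einsteinWeylGap M e (stub_einsteinReduction M e hfat)

end Summit.SmoothPoincare4.SmoothPoincare4.Cruxes.RecognitionBeyondWeylGap.Birth

end
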